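import Mathlib
import HarnessLib
import Summits.HubbardSuperconductivity.HubbardSuperconductivity.Theorems.KLProgrammeKLRegimeEnginePairLadderFlowStep

/-!
# Route `KLProgramme` — crux K3, ENGINE child gen 6 (stmt-HubbardSuperconductivity-20236 `KLRegimeEngineV16`), stub `stub_engine_step_values`,
# conjunct (E2-v10) at `1 ≤ n`: the CONJUGATED weighted Duhamel comparison — `kltc_riccati_duhamel_conjugated`

Cell gate-hubbard-kl, seat hubbard-kl-k3c1-p1 (g7), technique «composed-map remainder propagation».  Twin of `kltc_riccati_duhamel_weighted`
(p500198) for a within-slice pair-vertex flow that carries, besides the Riccati term and the source, a LINEAR term — the one-line tree of the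
Wick-ordered flow (`𝒲₂–Ċ–𝒲₄`, the k = 0 class), which at the pair labels is DIAGONAL: `Γ̇ = −Γ·diag ḃ·Γ − diag(α̇)·Γ − Γ·diag(γ̇) + X`.
FINDING (KL STATUS 2026-08-27T≈10:20Z, with p1 g10's E2-SIGMA-DRESSING): left inside the source, this term is charged at the INTERNAL (weighted)
indices of the four-term form — an `n`-uniform self-energy dressing of the rungs that no (E2-v10) token holds.  It is removed EXACTLY by conjugation:
with `a_t := α_t − α_0`-type cumulative dressings (`α 0 = γ 0 = 0`) and `Γ̃_t := diag(e^{α_t})·Γ_t·diag(e^{γ_t})`, the conjugated vertex solves the PLAIN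
Riccati flow `Γ̃̇ = −Γ̃·diag(ḃ·e^{−α−γ})·Γ̃ + diag(e^{α})·X·diag(e^{γ})` with DRESSED rungs, to which p500198 applies; the dressing of the EXTERNAL
legs is undone at the end and costs `(e^{|α₁(x)|+|γ₁(y)|} − 1)·(3/2)m` — the (D) shape of the slot — while the internal dressing lives in the step weight
`w̃ = ∫₀¹ ḃ_t e^{−α_t−γ_t} dt` (the `∃ w` of the slot admits it).

* `kltc_diag_mul_mul_diag_apply`, `kltc_norm_cexp_le_of_le` — bookkeeping;
* **`kltc_riccati_duhamel_conjugated`** — inputs: entrywise-C¹ `Γ` with derivative `Γ̇`, continuous rung RATE `ḃ` (no cumulative rung needed: the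
  dressed cumulative rung is built here by integration), C¹ diagonal dressings `α, γ` with continuous derivatives and `α 0 = γ 0 = 0`, the split
  `X = Γ̇ + Γ·diag ḃ·Γ + diag α̇·Γ + Γ·diag γ̇` (a DEFINITION of `X`), bounds `|Γ| ≤ m`, `‖α‖, ‖γ‖ ≤ A`, `Σ‖ḃ‖ ≤ β_r`, integral tails
  `∫_t^1 ‖ḃ_s(a)‖ds ≤ ρ_a`, smallness `(3/2)(e^{2A}m)(e^{2A}Σρ) ≤ 1/3`.  Output: `∃ N` two-sided inverse of `1 + diag(w̃)·Γ(0)`, `|Γ(0)N| ≤ (3/2)m`,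
  and `‖e^{α₁(x)}Γ(1)(x,y)e^{γ₁(y)} − (Γ(0)N)(x,y)‖ ≤ FT_{e^{2A}ρ, e^{2A}m}(Ĩ)(x,y)`, `Ĩ(x,y) = ∫₀¹‖e^{α_t(x)}X_t(x,y)e^{γ_t(y)}‖dt`,
  also `‖w̃_a‖ ≤ e^{2A}ρ_a`;
* `kltc_undress_external` — undoing the external dressing of one entry: `‖g − Y‖ ≤ e^{‖e‖+‖c‖}·F + (e^{‖e‖+‖c‖} − 1)(3/2)m`;
* **`kltc_wickStep_of_flow_conjugated`** (§2, product carrier `S × F`, twin of `kltc_wickStep_of_flow` p501252) — the conjugated comparison +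
  the undressing + the frequency localisation to a base array `C` on `S` (`klell_localised_ladder_rightInverse`): `∃ N` two-sided inverse of
  `1 + diag(Σ_ν w̃(·,ν))·C` with `‖Γ(1)(x,y) − (C·N)(x.1,y.1)‖ ≤ e^{‖α₁x‖+‖γ₁y‖}·FT(Ĩ)(x,y) + (e^{‖α₁x‖+‖γ₁y‖} − 1)(3/2)m + [‖Γ(0) − C^ext‖
  four-term weighted by ‖w̃‖]` — the input format of `kltc_tower_compose_fwd` / `pairLadderStepAtV10_of_wickTower_fwd` with DRESSED weights.

Real analysis over the landed comparison; nothing about the model is asserted.  0 kit.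
-/

noncomputable section

namespace Summit.HubbardSuperconductivity.HubbardSuperconductivity.Theorems.KLRegimeSplit

set_option linter.dupNamespace false -- summit = problem name (single-conjunct summit), D-0017

open Finset Matrix Set Literature.MathematicalPhysics.QuantumLattice Literature.Probability.LatticeModels
open Summit.HubbardSuperconductivity.HubbardSuperconductivity.Theorems.KLProgrammeCooperResummation
open scoped Topology

section Generic

variable {ι : Type*} [Fintype ι] [DecidableEq ι] [Nonempty ι]

omit [Nonempty ι] in
/-- Entries of a two-sided diagonal conjugation: `(diag e · M · diag g)(x,y) = e_x · M(x,y) · g_y`. -/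
theorem kltc_diag_mul_mul_diag_apply (e g : ι → ℂ) (M : Matrix ι ι ℂ) (x y : ι) :
    (diagonal e * M * diagonal g) x y = e x * M x y * g y := by
  rw [Matrix.mul_diagonal, Matrix.diagonal_mul]

/-- `‖e^{z}‖ ≤ e^{A}` when `‖z‖ ≤ A` (`‖e^z‖ = e^{Re z}`; the unconditional form is the tree's `norm_exp_le_exp_norm`). -/
theorem kltc_norm_cexp_le_of_le {z : ℂ} {A : ℝ} (h : ‖z‖ ≤ A) : ‖Complex.exp z‖ ≤ Real.exp A := by
  rw [Complex.norm_exp]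
  exact Real.exp_le_exp.2 ((Complex.re_le_norm z).trans h)

set_option maxHeartbeats 400000 in -- change of variables + the landed partition-limit comparison
/-- **Conjugated weighted Duhamel comparison.**  See the module docstring.  `Γ, Γ̇, X : ℝ → Matrix ι ι ℂ`, rung rate `ḃ : ℝ → ι → ℂ`, diagonal
dressings `α, γ : ℝ → ι → ℂ` with derivatives `α̇, γ̇`; all hypotheses on `[0,1]`. -/
theorem kltc_riccati_duhamel_conjugated (Γ Γ' X : ℝ → Matrix ι ι ℂ) (b' : ℝ → ι → ℂ) (α αd γ γd : ℝ → ι → ℂ) (ρ : ι → ℝ)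
    {m A βr : ℝ} (hm : 0 ≤ m) (hA : 0 ≤ A)
    (hΓ : ∀ t ∈ Icc (0 : ℝ) 1, ∀ x y, HasDerivAt (fun s => Γ s x y) (Γ' t x y) t)
    (hΓ'c : ∀ x y, ContinuousOn (fun t => Γ' t x y) (Icc 0 1))
    (hb'c : ∀ a, ContinuousOn (fun t => b' t a) (Icc 0 1))
    (hα : ∀ t ∈ Icc (0 : ℝ) 1, ∀ x, HasDerivAt (fun s => α s x) (αd t x) t)
    (hαdc : ∀ x, ContinuousOn (fun t => αd t x) (Icc 0 1))
    (hγ : ∀ t ∈ Icc (0 : ℝ) 1, ∀ x, HasDerivAt (fun s => γ s x) (γd t x) t)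
    (hγdc : ∀ x, ContinuousOn (fun t => γd t x) (Icc 0 1))
    (hα0 : α 0 = 0) (hγ0 : γ 0 = 0)
    (hX : ∀ t ∈ Icc (0 : ℝ) 1, X t = Γ' t + Γ t * diagonal (b' t) * Γ t + diagonal (αd t) * Γ t + Γ t * diagonal (γd t))
    (hΓm : ∀ t ∈ Icc (0 : ℝ) 1, ∀ x y, ‖Γ t x y‖ ≤ m)
    (hαA : ∀ t ∈ Icc (0 : ℝ) 1, ∀ x, ‖α t x‖ ≤ A) (hγA : ∀ t ∈ Icc (0 : ℝ) 1, ∀ x, ‖γ t x‖ ≤ A)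
    (hβ : ∀ t ∈ Icc (0 : ℝ) 1, ∑ a, ‖b' t a‖ ≤ βr)
    (hρ : ∀ t ∈ Icc (0 : ℝ) 1, ∀ a, ∫ s in t..1, ‖b' s a‖ ≤ ρ a)
    (hsm : 3 / 2 * (Real.exp (2 * A) * m) * ∑ a, Real.exp (2 * A) * ρ a ≤ 1 / 3) :
    ∃ N : Matrix ι ι ℂ,
      (1 + diagonal (fun a => ∫ s in (0 : ℝ)..1, b' s a * Complex.exp (-(α s a + γ s a))) * Γ 0) * N = 1 ∧
      N * (1 + diagonal (fun a => ∫ s in (0 : ℝ)..1, b' s a * Complex.exp (-(α s a + γ s a))) * Γ 0) = 1 ∧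
      (∀ x y, ‖(Γ 0 * N) x y‖ ≤ 3 / 2 * m) ∧
      (∀ a, ‖∫ s in (0 : ℝ)..1, b' s a * Complex.exp (-(α s a + γ s a))‖ ≤ Real.exp (2 * A) * ρ a) ∧
      ∀ x y, ‖Complex.exp (α 1 x) * Γ 1 x y * Complex.exp (γ 1 y) - (Γ 0 * N) x y‖ ≤
        (∫ t in (0 : ℝ)..1, ‖Complex.exp (α t x) * X t x y * Complex.exp (γ t y)‖) +
          3 / 2 * (3 / 2 * (Real.exp (2 * A) * m)) *
              ∑ c, (∫ t in (0 : ℝ)..1, ‖Complex.exp (α t x) * X t x c * Complex.exp (γ t c)‖) * (Real.exp (2 * A) * ρ c) +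
            3 / 2 * (Real.exp (2 * A) * m) *
              ∑ a, (Real.exp (2 * A) * ρ a) * (∫ t in (0 : ℝ)..1, ‖Complex.exp (α t a) * X t a y * Complex.exp (γ t y)‖) +
          9 / 4 * (Real.exp (2 * A) * m) * (3 / 2 * (Real.exp (2 * A) * m)) *
            ∑ a, ∑ c, (Real.exp (2 * A) * ρ a) *
              (∫ t in (0 : ℝ)..1, ‖Complex.exp (α t a) * X t a c * Complex.exp (γ t c)‖) * (Real.exp (2 * A) * ρ c) := by
  have h01 : (0 : ℝ) ∈ Icc (0 : ℝ) 1 := ⟨le_rfl, zero_le_one⟩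
  set eA : ℝ := Real.exp (2 * A) with heA_def
  have heA1 : 1 ≤ eA := Real.one_le_exp (by positivity)
  have heA0 : 0 < eA := Real.exp_pos _
  -- clamp to `[0,1]` and the extended rung rate
  set π : ℝ → ℝ := fun s => max 0 (min 1 s) with hπ_def
  have hπc : Continuous π := continuous_const.max (continuous_const.min continuous_id)
  have hπmem : ∀ s, π s ∈ Icc (0 : ℝ) 1 := fun s =>
    ⟨le_max_left _ _, max_le zero_le_one (min_le_left _ _)⟩
  have hπid : ∀ s ∈ Icc (0 : ℝ) 1, π s = s := fun s hs => by
    rw [hπ_def]; dsimp only; rw [min_eq_right hs.2, max_eq_right hs.1]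
  -- continuity of `α`, `γ` on `[0,1]`
  have hαc : ∀ x, ContinuousOn (fun t => α t x) (Icc 0 1) := fun x t ht => (hα t ht x).continuousAt.continuousWithinAt
  have hγc : ∀ x, ContinuousOn (fun t => γ t x) (Icc 0 1) := fun x t ht => (hγ t ht x).continuousAt.continuousWithinAt
  have hΓc : ∀ x y, ContinuousOn (fun t => Γ t x y) (Icc 0 1) := fun x y t ht => (hΓ t ht x y).continuousAt.continuousWithinAt
  -- the dressed rung rate, extended continuously to `ℝ`
  set bt' : ℝ → ι → ℂ := fun s a => b' (π s) a * Complex.exp (-(α (π s) a + γ (π s) a)) with hbt'_def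
  have hbt'cont : ∀ a, Continuous fun s => bt' s a := by
    intro a
    have h1 : Continuous fun s => b' (π s) a := (hb'c a).comp_continuous hπc (hπmem)
    have h2 : Continuous fun s => α (π s) a := (hαc a).comp_continuous hπc hπmem
    have h3 : Continuous fun s => γ (π s) a := (hγc a).comp_continuous hπc hπmem
    exact h1.mul (Complex.continuous_exp.comp ((h2.add h3).neg))
  have hbt'on : ∀ s ∈ Icc (0 : ℝ) 1, ∀ a, bt' s a = b' s a * Complex.exp (-(α s a + γ s a)) := fun s hs a => by
    simp only [hbt'_def, hπid s hs]
  -- the dressed cumulative rung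
  set bt : ℝ → ι → ℂ := fun t a => ∫ s in (0 : ℝ)..t, bt' s a with hbt_def
  have hbt : ∀ t ∈ Icc (0 : ℝ) 1, ∀ a, HasDerivAt (fun s => bt s a) (bt' t a) t := by
    intro t _ a
    simp only [hbt_def]
    exact intervalIntegral.integral_hasDerivAt_right ((hbt'cont a).intervalIntegrable _ _)
      ((hbt'cont a).stronglyMeasurableAtFilter _ _) (hbt'cont a).continuousAt
  have hbt'c : ∀ a, ContinuousOn (fun t => bt' t a) (Icc 0 1) := fun a => (hbt'cont a).continuousOn
  have hbt0 : bt 0 = 0 := by funext a; simp [hbt_def]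
  -- the conjugated vertex and its derivative
  set E : ℝ → ι → ℂ := fun t x => Complex.exp (α t x) with hE_def
  set G : ℝ → ι → ℂ := fun t x => Complex.exp (γ t x) with hG_def
  set Γt : ℝ → Matrix ι ι ℂ := fun t => diagonal (E t) * Γ t * diagonal (G t) with hΓt_def
  set Γt' : ℝ → Matrix ι ι ℂ := fun t => Matrix.of fun x y =>
    (E t x * αd t x * Γ t x y + E t x * Γ' t x y) * G t y + E t x * Γ t x y * (G t y * γd t y) with hΓt'_def
  set Xt : ℝ → Matrix ι ι ℂ := fun t => diagonal (E t) * X t * diagonal (G t) with hXt_def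
  have hE : ∀ t ∈ Icc (0 : ℝ) 1, ∀ x, HasDerivAt (fun s => E s x) (E t x * αd t x) t := fun t ht x => (hα t ht x).cexp
  have hG : ∀ t ∈ Icc (0 : ℝ) 1, ∀ x, HasDerivAt (fun s => G s x) (G t x * γd t x) t := fun t ht x => (hγ t ht x).cexp
  have hΓt : ∀ t ∈ Icc (0 : ℝ) 1, ∀ x y, HasDerivAt (fun s => Γt s x y) (Γt' t x y) t := by
    intro t ht x y
    have h := ((hE t ht x).mul (hΓ t ht x y)).mul (hG t ht y)
    have hfun : (fun s => Γt s x y) = ((fun s => E s x) * fun s => Γ s x y) * fun s => G s y := by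
      funext s; simp only [hΓt_def, kltc_diag_mul_mul_diag_apply, Pi.mul_apply]
    rw [hfun]
    refine h.congr_deriv ?_
    simp only [hΓt'_def, Matrix.of_apply, Pi.mul_apply]
  have hEc : ∀ x, ContinuousOn (fun t => E t x) (Icc 0 1) := fun x => (hαc x).cexp
  have hGc : ∀ x, ContinuousOn (fun t => G t x) (Icc 0 1) := fun x => (hγc x).cexp
  have hΓt'c : ∀ x y, ContinuousOn (fun t => Γt' t x y) (Icc 0 1) := by
    intro x y
    simp only [hΓt'_def, Matrix.of_apply]
    exact ((((((hEc x).mul (hαdc x)).mul (hΓc x y)).add ((hEc x).mul (hΓ'c x y))).mul (hGc y)).add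
      (((hEc x).mul (hΓc x y)).mul ((hGc y).mul (hγdc y))))
  -- the conjugated flow equation
  have hcancel : ∀ t a (w : ℂ), G t a * (w * Complex.exp (-(α t a + γ t a))) * E t a = w := by
    intro t a w
    simp only [hE_def, hG_def]
    rw [Complex.exp_neg, Complex.exp_add]
    field_simp
  have hXt : ∀ t ∈ Icc (0 : ℝ) 1, Xt t = Γt' t + Γt t * diagonal (bt' t) * Γt t := by
    intro t ht
    ext x y
    simp only [hXt_def, hΓt'_def, hΓt_def, Matrix.add_apply, Matrix.of_apply, hX t ht, klli_mul_diag_mul_apply, Matrix.diagonal_mul,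
      Matrix.mul_diagonal, hbt'on t ht]
    have hsum : ∑ b_1, E t x * Γ t x b_1 * G t b_1 * (b' t b_1 * Complex.exp (-(α t b_1 + γ t b_1))) * (E t b_1 * Γ t b_1 y * G t y) =
        E t x * (∑ b_1, Γ t x b_1 * b' t b_1 * Γ t b_1 y) * G t y := by
      rw [Finset.mul_sum, Finset.sum_mul]
      refine sum_congr rfl fun a _ => ?_
      have h := hcancel t a (b' t a)
      calc E t x * Γ t x a * G t a * (b' t a * Complex.exp (-(α t a + γ t a))) * (E t a * Γ t a y * G t y)
          = E t x * Γ t x a * (G t a * (b' t a * Complex.exp (-(α t a + γ t a))) * E t a) * Γ t a y * G t y := by ring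
        _ = E t x * (Γ t x a * b' t a * Γ t a y) * G t y := by rw [h]; ring
    rw [hsum]
    ring
  -- bounds for the conjugated data
  have hEn : ∀ t ∈ Icc (0 : ℝ) 1, ∀ x, ‖E t x‖ ≤ Real.exp A := fun t ht x => kltc_norm_cexp_le_of_le (hαA t ht x)
  have hGn : ∀ t ∈ Icc (0 : ℝ) 1, ∀ x, ‖G t x‖ ≤ Real.exp A := fun t ht x => kltc_norm_cexp_le_of_le (hγA t ht x)
  have heAA : Real.exp A * Real.exp A = eA := by rw [heA_def, ← Real.exp_add]; ring_nf
  have hΓtm : ∀ t ∈ Icc (0 : ℝ) 1, ∀ x y, ‖Γt t x y‖ ≤ eA * m := by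
    intro t ht x y
    simp only [hΓt_def, kltc_diag_mul_mul_diag_apply]
    calc ‖E t x * Γ t x y * G t y‖ = ‖E t x‖ * ‖Γ t x y‖ * ‖G t y‖ := by rw [norm_mul, norm_mul]
      _ ≤ Real.exp A * m * Real.exp A := by
          gcongr
          · exact hEn t ht x
          · exact hΓm t ht x y
          · exact hGn t ht y
      _ = eA * m := by rw [← heAA]; ring
  have hexpneg : ∀ t ∈ Icc (0 : ℝ) 1, ∀ a, ‖Complex.exp (-(α t a + γ t a))‖ ≤ eA := by
    intro t ht a
    refine (kltc_norm_cexp_le_of_le (A := 2 * A) ?_).trans le_rfl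
    calc ‖-(α t a + γ t a)‖ = ‖α t a + γ t a‖ := norm_neg _
      _ ≤ ‖α t a‖ + ‖γ t a‖ := norm_add_le _ _
      _ ≤ A + A := add_le_add (hαA t ht a) (hγA t ht a)
      _ = 2 * A := by ring
  have hbt'n : ∀ t ∈ Icc (0 : ℝ) 1, ∀ a, ‖bt' t a‖ ≤ eA * ‖b' t a‖ := by
    intro t ht a
    rw [hbt'on t ht a, norm_mul, mul_comm]
    exact mul_le_mul_of_nonneg_right (hexpneg t ht a) (norm_nonneg _)
  have hβt : ∀ t ∈ Icc (0 : ℝ) 1, ∑ a, ‖bt' t a‖ ≤ eA * βr := by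
    intro t ht
    calc ∑ a, ‖bt' t a‖ ≤ ∑ a, eA * ‖b' t a‖ := sum_le_sum fun a _ => hbt'n t ht a
      _ = eA * ∑ a, ‖b' t a‖ := by rw [Finset.mul_sum]
      _ ≤ eA * βr := mul_le_mul_of_nonneg_left (hβ t ht) heA0.le
  have hρt : ∀ t ∈ Icc (0 : ℝ) 1, ∀ a, ‖bt 1 a - bt t a‖ ≤ eA * ρ a := by
    intro t ht a
    have hint : ∀ u v : ℝ, IntervalIntegrable (fun s => bt' s a) MeasureTheory.volume u v := fun u v =>
      (hbt'cont a).intervalIntegrable _ _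
    have hsub : bt 1 a - bt t a = ∫ s in t..1, bt' s a := by
      simp only [hbt_def]
      rw [← intervalIntegral.integral_add_adjacent_intervals (hint 0 t) (hint t 1)]
      ring
    rw [hsub]
    have ht1 : t ≤ 1 := ht.2
    calc ‖∫ s in t..1, bt' s a‖ ≤ ∫ s in t..1, ‖bt' s a‖ := intervalIntegral.norm_integral_le_integral_norm ht1
      _ ≤ ∫ s in t..1, eA * ‖b' s a‖ := by
          refine intervalIntegral.integral_mono_on ht1 ((hint t 1).norm) ?_ fun s hs => hbt'n s ⟨ht.1.trans hs.1, hs.2⟩ a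
          exact ((continuousOn_const.mul ((hb'c a).norm)).mono (Icc_subset_Icc ht.1 le_rfl)).intervalIntegrable_of_Icc ht1
      _ = eA * ∫ s in t..1, ‖b' s a‖ := by rw [intervalIntegral.integral_const_mul]
      _ ≤ eA * ρ a := mul_le_mul_of_nonneg_left (hρ t ht a) heA0.le
  have hsmt : 3 / 2 * (eA * m) * ∑ a, eA * ρ a ≤ 1 / 3 := hsm
  -- the landed comparison on the conjugated data
  obtain ⟨N, hN1, hN2, hbound⟩ := kltc_riccati_duhamel_weighted Γt Γt' Xt bt bt' (fun a => eA * ρ a) (by positivity) hΓt hbt hΓt'c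
    hbt'c hXt hΓtm hβt hρt hsmt
  -- identify `Γt 0 = Γ 0` and the weight
  have hE0 : E 0 = fun _ => 1 := by funext x; simp [hE_def, hα0]
  have hG0 : G 0 = fun _ => 1 := by funext x; simp [hG_def, hγ0]
  have hΓt0 : Γt 0 = Γ 0 := by
    simp only [hΓt_def, hE0, hG0]
    rw [show (diagonal fun _ : ι => (1 : ℂ)) = 1 from diagonal_one, Matrix.one_mul, Matrix.mul_one]
  have hw : bt 1 - bt 0 = fun a => ∫ s in (0 : ℝ)..1, b' s a * Complex.exp (-(α s a + γ s a)) := by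
    rw [hbt0, sub_zero]
    funext a
    simp only [hbt_def]
    refine intervalIntegral.integral_congr fun s hs => ?_
    rw [Set.uIcc_of_le zero_le_one] at hs
    exact hbt'on s hs a
  rw [hΓt0, hw] at hN1 hN2
  rw [hΓt0] at hbound
  -- entry bound of `Γ 0 · N` by uniqueness of the inverse
  have hρ0 : ∀ a, 0 ≤ ρ a := fun a => by
    have h := hρ 1 ⟨zero_le_one, le_rfl⟩ a
    rw [intervalIntegral.integral_same] at h
    exact h
  have h1 : ∀ a, ‖∫ s in (0 : ℝ)..1, b' s a * Complex.exp (-(α s a + γ s a))‖ ≤ eA * ρ a := by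
    intro a
    have h := hρt 0 h01 a
    rw [hbt0, Pi.zero_apply, sub_zero] at h
    have h' : bt 1 a = ∫ s in (0 : ℝ)..1, b' s a * Complex.exp (-(α s a + γ s a)) := by
      have := congrFun hw a; rw [hbt0, Pi.sub_apply, Pi.zero_apply, sub_zero] at this; exact this
    rw [← h']; exact h
  have hwm : m * ∑ a, ‖(fun a => ∫ s in (0 : ℝ)..1, b' s a * Complex.exp (-(α s a + γ s a))) a‖ ≤ 1 / 3 := by
    have hZ0 : 0 ≤ ∑ a, eA * ρ a := sum_nonneg fun a _ => mul_nonneg heA0.le (hρ0 a)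
    calc m * ∑ a, ‖(fun a => ∫ s in (0 : ℝ)..1, b' s a * Complex.exp (-(α s a + γ s a))) a‖ ≤ m * ∑ a, eA * ρ a :=
          mul_le_mul_of_nonneg_left (sum_le_sum fun a _ => h1 a) hm
      _ ≤ 3 / 2 * (eA * m) * ∑ a, eA * ρ a := by
          have hm' : m ≤ 3 / 2 * (eA * m) := by nlinarith
          exact mul_le_mul_of_nonneg_right hm' hZ0
      _ ≤ 1 / 3 := hsmt
  obtain ⟨N₁, _, hN₁1, hN₁2, -, -, -, -, -, hCN₁, -, -⟩ := klcrs_single_slice _ hm (Γ 0) (hΓm 0 h01) hwm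
  have hNN : N = N₁ := by
    calc N = N₁ * (1 + diagonal (fun a => ∫ s in (0 : ℝ)..1, b' s a * Complex.exp (-(α s a + γ s a))) * Γ 0) * N := by
          rw [hN₁2, Matrix.one_mul]
      _ = N₁ := by rw [Matrix.mul_assoc, hN1, Matrix.mul_one]
  refine ⟨N, hN1, hN2, fun x y => by rw [hNN]; exact hCN₁ x y, h1, fun x y => ?_⟩
  have h := hbound x y
  have hΓt1 : Γt 1 x y = Complex.exp (α 1 x) * Γ 1 x y * Complex.exp (γ 1 y) := by
    simp only [hΓt_def, kltc_diag_mul_mul_diag_apply, hE_def, hG_def]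
  have hXt' : ∀ t a c, Xt t a c = Complex.exp (α t a) * X t a c * Complex.exp (γ t c) := fun t a c => by
    simp only [hXt_def, kltc_diag_mul_mul_diag_apply, hE_def, hG_def]
  simp only [hΓt1, hXt'] at h
  exact h

/-- **Undressing one entry** (scalar bookkeeping): if `‖Y‖ ≤ (3/2)m` and `‖e^{e}·g·e^{c} − Y‖ ≤ F` then
`‖g − Y‖ ≤ e^{‖e‖+‖c‖}·F + (e^{‖e‖+‖c‖} − 1)·(3/2)m` — the external dressing is undone at the cost of a (D)-shaped term. -/
theorem kltc_undress_external {g e c Y : ℂ} {m F : ℝ} (hY : ‖Y‖ ≤ 3 / 2 * m)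
    (hF : ‖Complex.exp e * g * Complex.exp c - Y‖ ≤ F) :
    ‖g - Y‖ ≤ Real.exp (‖e‖ + ‖c‖) * F + (Real.exp (‖e‖ + ‖c‖) - 1) * (3 / 2 * m) := by
  have hnorm : ‖-(e + c)‖ ≤ ‖e‖ + ‖c‖ := by rw [norm_neg]; exact norm_add_le _ _
  have hv_n : ‖Complex.exp (-(e + c))‖ ≤ Real.exp (‖e‖ + ‖c‖) := kltc_norm_cexp_le_of_le hnorm
  have hv1 : ‖Complex.exp (-(e + c)) - 1‖ ≤ Real.exp (‖e‖ + ‖c‖) - 1 := by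
    -- `‖e^z − 1‖ ≤ e^{‖z‖} − 1` (the tree's `norm_cexp_sub_one_le_exp_norm_sub_one`, via Mathlib's partial-sum bound)
    have h := Complex.norm_exp_sub_sum_le_exp_norm_sub_sum (-(e + c)) 1
    have h1 : ‖Complex.exp (-(e + c)) - 1‖ ≤ Real.exp ‖-(e + c)‖ - 1 := by simpa using h
    exact h1.trans (sub_le_sub_right (Real.exp_le_exp.2 hnorm) 1)
  have hone : Complex.exp (-(e + c)) * Complex.exp e * Complex.exp c = 1 := by
    rw [← Complex.exp_add, ← Complex.exp_add, show -(e + c) + e + c = 0 by ring, Complex.exp_zero]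
  have hid : Complex.exp (-(e + c)) * (Complex.exp e * g * Complex.exp c) = g := by
    calc Complex.exp (-(e + c)) * (Complex.exp e * g * Complex.exp c) = (Complex.exp (-(e + c)) * Complex.exp e * Complex.exp c) * g := by
          ring
      _ = g := by rw [hone, one_mul]
  have key : g - Y = Complex.exp (-(e + c)) * (Complex.exp e * g * Complex.exp c - Y) + (Complex.exp (-(e + c)) - 1) * Y := by
    linear_combination -hid
  rw [key]
  calc ‖Complex.exp (-(e + c)) * (Complex.exp e * g * Complex.exp c - Y) + (Complex.exp (-(e + c)) - 1) * Y‖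
      ≤ ‖Complex.exp (-(e + c)) * (Complex.exp e * g * Complex.exp c - Y)‖ + ‖(Complex.exp (-(e + c)) - 1) * Y‖ := norm_add_le _ _
    _ = ‖Complex.exp (-(e + c))‖ * ‖Complex.exp e * g * Complex.exp c - Y‖ + ‖Complex.exp (-(e + c)) - 1‖ * ‖Y‖ := by
        rw [norm_mul, norm_mul]
    _ ≤ Real.exp (‖e‖ + ‖c‖) * F + (Real.exp (‖e‖ + ‖c‖) - 1) * (3 / 2 * m) :=
        add_le_add (mul_le_mul hv_n hF (norm_nonneg _) (Real.exp_pos _).le)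
          (mul_le_mul hv1 hY (norm_nonneg _) (sub_nonneg.2 (Real.one_le_exp (by positivity))))

/-! ## §2 Product carrier: conjugated Wick step with frequency localisation -/

section Product

variable {S F : Type*} [Fintype S] [DecidableEq S] [Nonempty S] [Fintype F] [DecidableEq F] [Nonempty F]

/-- **Conjugated Wick step on the product carrier** (twin of `kltc_wickStep_of_flow`, p501252, with the linear leg term conjugated away).
`Γ, Γ̇, X` on `S × F`, rung rate `ḃ`, diagonal dressings `α, γ` (derivatives `α̇, γ̇`, `α 0 = γ 0 = 0`), split
`X = Γ̇ + Γ·diag ḃ·Γ + diag α̇·Γ + Γ·diag γ̇`; base array `C` on `S` (`|C| ≤ m₀`); bounds `|Γ| ≤ m`, `‖α‖,‖γ‖ ≤ A`, rate `Σ‖ḃ‖ ≤ β_r`, integral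
tails `∫_t^1‖ḃ_s(a)‖ds ≤ ρ_a`; smallness `(3/2)(e^{2A}m)(Σe^{2A}ρ) ≤ 1/3`, `m₀·Σe^{2A}ρ ≤ 1/3`; the DRESSED step weight
`W a = ∫₀¹ ḃ_s(a)e^{−α_s(a)−γ_s(a)}ds` (pass `rfl`).  THEN `∃ N` two-sided inverse of `1 + diag(Σ_ν W(·,ν))·C`, `|C·N| ≤ (3/2)m₀`,
`‖W a‖ ≤ e^{2A}ρ_a`, and for all `x y`:
`‖Γ(1)(x,y) − (C·N)(x.1,y.1)‖ ≤ e^{‖α₁x‖+‖γ₁y‖}·FT_{e^{2A}ρ, e^{2A}m}(Ĩ)(x,y) + (e^{‖α₁x‖+‖γ₁y‖} − 1)·(3/2)m + [‖Γ(0) − C^ext‖ four-term weighted by ‖W‖]`,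
`Ĩ(x,y) = ∫₀¹‖e^{α_t x}X_t(x,y)e^{γ_t y}‖dt`. -/
theorem kltc_wickStep_of_flow_conjugated (C : Matrix S S ℂ) (Γ Γ' X : ℝ → Matrix (S × F) (S × F) ℂ) (b' : ℝ → S × F → ℂ)
    (α αd γ γd : ℝ → S × F → ℂ) (ρ : S × F → ℝ) (W : S × F → ℂ) {m m₀ A βr : ℝ} (hm : 0 ≤ m) (hm₀ : 0 ≤ m₀) (hA : 0 ≤ A)
    (hC : ∀ s t, ‖C s t‖ ≤ m₀)
    (hΓ : ∀ t ∈ Icc (0 : ℝ) 1, ∀ x y, HasDerivAt (fun s => Γ s x y) (Γ' t x y) t)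
    (hΓ'c : ∀ x y, ContinuousOn (fun t => Γ' t x y) (Icc 0 1))
    (hb'c : ∀ a, ContinuousOn (fun t => b' t a) (Icc 0 1))
    (hα : ∀ t ∈ Icc (0 : ℝ) 1, ∀ x, HasDerivAt (fun s => α s x) (αd t x) t)
    (hαdc : ∀ x, ContinuousOn (fun t => αd t x) (Icc 0 1))
    (hγ : ∀ t ∈ Icc (0 : ℝ) 1, ∀ x, HasDerivAt (fun s => γ s x) (γd t x) t)
    (hγdc : ∀ x, ContinuousOn (fun t => γd t x) (Icc 0 1))
    (hα0 : α 0 = 0) (hγ0 : γ 0 = 0)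
    (hX : ∀ t ∈ Icc (0 : ℝ) 1, X t = Γ' t + Γ t * diagonal (b' t) * Γ t + diagonal (αd t) * Γ t + Γ t * diagonal (γd t))
    (hΓm : ∀ t ∈ Icc (0 : ℝ) 1, ∀ x y, ‖Γ t x y‖ ≤ m)
    (hαA : ∀ t ∈ Icc (0 : ℝ) 1, ∀ x, ‖α t x‖ ≤ A) (hγA : ∀ t ∈ Icc (0 : ℝ) 1, ∀ x, ‖γ t x‖ ≤ A)
    (hβ : ∀ t ∈ Icc (0 : ℝ) 1, ∑ a, ‖b' t a‖ ≤ βr)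
    (hρ : ∀ t ∈ Icc (0 : ℝ) 1, ∀ a, ∫ s in t..1, ‖b' s a‖ ≤ ρ a)
    (hsm : 3 / 2 * (Real.exp (2 * A) * m) * ∑ a, Real.exp (2 * A) * ρ a ≤ 1 / 3)
    (hsm₀ : m₀ * ∑ a, Real.exp (2 * A) * ρ a ≤ 1 / 3)
    (hW : W = fun a => ∫ s in (0 : ℝ)..1, b' s a * Complex.exp (-(α s a + γ s a))) :
    ∃ N : Matrix S S ℂ, (1 + diagonal (fun s => ∑ c : F, W (s, c)) * C) * N = 1 ∧
      N * (1 + diagonal (fun s => ∑ c : F, W (s, c)) * C) = 1 ∧ (∀ s t, ‖(C * N) s t‖ ≤ 3 / 2 * m₀) ∧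
      (∀ a, ‖W a‖ ≤ Real.exp (2 * A) * ρ a) ∧
      ∀ x y : S × F, ‖Γ 1 x y - (C * N) x.1 y.1‖ ≤
        (Real.exp (‖α 1 x‖ + ‖γ 1 y‖) *
            ((∫ t in (0 : ℝ)..1, ‖Complex.exp (α t x) * X t x y * Complex.exp (γ t y)‖) +
              3 / 2 * (3 / 2 * (Real.exp (2 * A) * m)) *
                  ∑ c, (∫ t in (0 : ℝ)..1, ‖Complex.exp (α t x) * X t x c * Complex.exp (γ t c)‖) * (Real.exp (2 * A) * ρ c) +
                3 / 2 * (Real.exp (2 * A) * m) *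
                  ∑ a, (Real.exp (2 * A) * ρ a) * (∫ t in (0 : ℝ)..1, ‖Complex.exp (α t a) * X t a y * Complex.exp (γ t y)‖) +
              9 / 4 * (Real.exp (2 * A) * m) * (3 / 2 * (Real.exp (2 * A) * m)) *
                ∑ a, ∑ c, (Real.exp (2 * A) * ρ a) *
                  (∫ t in (0 : ℝ)..1, ‖Complex.exp (α t a) * X t a c * Complex.exp (γ t c)‖) * (Real.exp (2 * A) * ρ c)) +
          (Real.exp (‖α 1 x‖ + ‖γ 1 y‖) - 1) * (3 / 2 * m)) +
        (‖Γ 0 x y - C x.1 y.1‖ + 3 / 2 * m₀ * ∑ c, ‖Γ 0 x c - C x.1 c.1‖ * ‖W c‖ +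
          3 / 2 * m * ∑ a, ‖W a‖ * ‖Γ 0 a y - C a.1 y.1‖ +
            9 / 4 * m * m₀ * ∑ a, ∑ c, ‖W a‖ * ‖Γ 0 a c - C a.1 c.1‖ * ‖W c‖) := by
  have h01 : (0 : ℝ) ∈ Icc (0 : ℝ) 1 := ⟨le_rfl, zero_le_one⟩
  have heA1 : 1 ≤ Real.exp (2 * A) := Real.one_le_exp (by positivity)
  obtain ⟨ND, hND1, -, hCND, hWρ, hDuh⟩ := kltc_riccati_duhamel_conjugated Γ Γ' X b' α αd γ γd ρ hm hA hΓ hΓ'c hb'c hα hαdc hγ hγdc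
    hα0 hγ0 hX hΓm hαA hγA hβ hρ hsm
  rw [← hW] at hND1
  replace hWρ : ∀ a, ‖W a‖ ≤ Real.exp (2 * A) * ρ a := fun a => by simpa only [hW] using hWρ a
  have hρ0 : ∀ a, 0 ≤ ρ a := fun a => by
    have h := hρ 1 ⟨zero_le_one, le_rfl⟩ a
    rw [intervalIntegral.integral_same] at h
    exact h
  have hZ_le : ∑ a, ‖W a‖ ≤ ∑ a, Real.exp (2 * A) * ρ a := sum_le_sum fun a _ => hWρ a
  have hZ0 : 0 ≤ ∑ a, Real.exp (2 * A) * ρ a := sum_nonneg fun a _ => mul_nonneg (Real.exp_pos _).le (hρ0 a)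
  have hzK : m * ∑ a, ‖W a‖ ≤ 1 / 3 := by
    have h1 : m ≤ 3 / 2 * (Real.exp (2 * A) * m) := by nlinarith
    exact ((mul_le_mul_of_nonneg_left hZ_le hm).trans (mul_le_mul_of_nonneg_right h1 hZ0)).trans hsm
  have hzC : m₀ * ∑ a, ‖W a‖ ≤ 1 / 3 := (mul_le_mul_of_nonneg_left hZ_le hm₀).trans hsm₀
  have hTK := (klcrs_single_slice_ladder_hasSum W hm (Γ 0) (hΓm 0 h01) hzK ND hND1).2
  obtain ⟨N, hN1, hN2, hCN, -, hloc⟩ := klell_localised_ladder_rightInverse C (Γ 0) W hm₀ hm hC (hΓm 0 h01) hzC hzK (Γ 0 * ND) hTK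
  refine ⟨N, hN1, hN2, hCN, hWρ, fun x y => ?_⟩
  have hsplit : Γ 1 x y - (C * N) x.1 y.1 = (Γ 1 x y - (Γ 0 * ND) x y) + ((Γ 0 * ND) x y - (C * N) x.1 y.1) := by ring
  rw [hsplit]
  exact (norm_add_le _ _).trans (add_le_add (kltc_undress_external (hCND x y) (hDuh x y)) (hloc x y))

end Product

end Generic

end Summit.HubbardSuperconductivity.HubbardSuperconductivity.Theorems.KLRegimeSplit

end
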